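import Summits.Ventures.PercRepro.ProfilePointedCircuitClassesStarSharpD0J

/-!
# PercRepro — CASE D0 OF `StarNineSharp`, PART K: THE INSTANCE OF THE PROP IN THE «NO ON LINE» REGIME, WITH THE
PAIRWISE HYPOTHESES (p5, gen 54; `proofs/P5-GM1.md` §81 (c))

`exists_indep_pair_of_two_le_rk`: a set of rank `≥ 2` contains two points of rank `2`; hence the pairwise form of
«no ON line» (`∀ x ≠ y ∈ E₇, ρ{x, y} = 2 → ρ{x, y, b, b′} = 4`) gives the set form used by D0J
(`no_on_line_of_pairs`), and **`starNineSharp_instance_of_no_on_line`** states the regime theorem with the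
hypotheses of `StarNineSharp` plus the pairwise regime conditions: `ρ(E₇) = 4`, no ON line, `e` and `f` simple on
`X = E₇ − e − f`, `ρ{e, f} = 2`, `ρ(X) = 4`.
-/

open scoped Matroid

namespace PercRepro.Cogirth

open Finset ThmH Skew Shadow Profile

variable {α : Type} [DecidableEq α] {N : Matroid α} [N.Finite]

section StarSharpD0K

variable {b b' : α}

/-- A set of rank `≥ 2` contains two distinct points spanning rank `2`. -/
theorem exists_indep_pair_of_two_le_rk {S : Finset α} (hS : 2 ≤ rk N S) :
    ∃ x ∈ S, ∃ y ∈ S, x ≠ y ∧ rk N {x, y} = 2 := by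
  by_contra hno
  push Not at hno
  -- a point of rank `1`
  by_cases hx : ∃ x ∈ S, rk N {x} = 1
  · obtain ⟨x, hxS, hx1⟩ := hx
    have hall : ∀ y ∈ S, rk N (insert y {x}) = rk N {x} := by
      intro y hyS
      by_cases hxy : x = y
      · rw [hxy, insert_eq_of_mem (mem_singleton_self _)]
      · have h1 : rk N (insert y {x}) ≤ 2 := by
          have := rk_le_card' (M := N) (insert y {x})
          rw [card_pair (Ne.symm hxy)] at this; exact this
        have h2 : rk N {x} ≤ rk N (insert y {x}) := rk_mono' (M := N) (subset_insert _ _)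
        have h3 : rk N (insert y {x}) ≠ 2 := hno y hyS x hxS (Ne.symm hxy)
        rw [hx1]; omega
    have := rk_union_eq_of_forall_insert_eq (N := N) (Y := {x}) S hall
    have h4 : rk N S ≤ rk N ({x} ∪ S) := rk_mono' (M := N) subset_union_right
    omega
  · push Not at hx
    have hall : ∀ y ∈ S, rk N (insert y (∅ : Finset α)) = rk N ∅ := by
      intro y hyS
      have h1 := rk_le_card' (M := N) {y}
      rw [card_singleton] at h1
      have h2 := hx y hyS
      have h3 : rk N (∅ : Finset α) ≤ rk N {y} := rk_mono' (M := N) (empty_subset _)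
      have h4 : rk N (∅ : Finset α) ≤ 0 := by
        have := rk_le_card' (M := N) (∅ : Finset α)
        rw [card_empty] at this; exact this
      rw [insert_empty]; omega
    have := rk_union_eq_of_forall_insert_eq (N := N) (Y := ∅) S hall
    rw [empty_union] at this
    have h4 : rk N (∅ : Finset α) ≤ 0 := by
      have := rk_le_card' (M := N) (∅ : Finset α)
      rw [card_empty] at this; exact this
    omega

/-- The pairwise form of «no ON line» gives the set form. -/
theorem no_on_line_of_pairs (h : SeriesPair N b b')
    (hnl : ∀ x ∈ ((gr N).erase b).erase b', ∀ y ∈ ((gr N).erase b).erase b', x ≠ y → rk N {x, y} = 2 →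
      rk N (insert b (insert b' {x, y})) = 4) :
    ∀ S : Finset α, S ⊆ ((gr N).erase b).erase b' → rk N (insert b (insert b' S)) ≤ 3 → rk N S ≤ 1 := by
  intro S hS hS3
  by_contra hlt
  push Not at hlt
  obtain ⟨x, hxS, y, hyS, hxy, hxy2⟩ := exists_indep_pair_of_two_le_rk (N := N) (S := S) (by omega)
  have h4 := hnl x (hS hxS) y (hS hyS) hxy hxy2
  have h5 : rk N (insert b (insert b' {x, y})) ≤ rk N (insert b (insert b' S)) := rk_mono' (M := N)
    (insert_subset_insert b (insert_subset_insert b' (by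
      intro z hz; simp only [mem_insert, mem_singleton] at hz
      rcases hz with rfl | rfl <;> assumption)))
  have _ := h
  omega

/-- **THE INSTANCE OF `StarNineSharp` IN THE «NO ON LINE» REGIME OF CASE D0**, with the Prop's hypotheses and the
pairwise regime conditions. -/
theorem starNineSharp_instance_of_no_on_line (hn : (gr N).card = 9) (hR : rk N (gr N) = 5)
    (hcf : ∀ x ∈ gr N, rk N ((gr N).erase x) = 5) {b b' e f : α} (h : SeriesPair N b b')
    (he : e ∈ gr N) (hf : f ∈ gr N) (hef : e ≠ f) (heb : e ≠ b) (heb' : e ≠ b') (hfb : f ≠ b) (hfb' : f ≠ b')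
    (hE7 : rk N (((gr N).erase b).erase b') = 4)
    (hnl : ∀ x ∈ ((gr N).erase b).erase b', ∀ y ∈ ((gr N).erase b).erase b', x ≠ y → rk N {x, y} = 2 →
      rk N (insert b (insert b' {x, y})) = 4)
    (he1 : ∀ y ∈ ((((gr N).erase b).erase b').erase f).erase e, rk N {e, y} = 2)
    (hf1 : ∀ y ∈ ((((gr N).erase b).erase b').erase f).erase e, rk N {f, y} = 2)
    (hef2 : rk N {e, f} = 2) (hX : rk N (((((gr N).erase b).erase b').erase f).erase e) = 4) :
    inCount N 4 e + thruCount N 4 {b', f} + thruCount N 4 {b', e, f} ≤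
      inCount N 4 f + thruCount N 4 {e, f} + thruCount N 4 {b', e} :=
  inCount_thru_le_of_no_on_line hn hR hcf h he hf hef heb heb' hfb hfb' hE7 (no_on_line_of_pairs h hnl) he1 hf1 hef2 hX

end StarSharpD0K

end PercRepro.Cogirth
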